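import Mathlib
import Summits.BirchSwinnertonDyer.BirchSwinnertonDyer.Theorems.ManinLocalTwoThreeOddDegreeLValueDenominator
import Literature.NumberTheory.EllipticCurves.SkinnerUrban2014.PAdicUnitPeriodRatioAnyPrimeProofs
import Literature.NumberTheory.EllipticCurves.BSDQuadraticDescentPeriodEliminationProofs
import HarnessLib

/-!
# `N = 4p`, TWO real components, lattice-optimal, odd degree: `12·L(E,1)/Ω⁺_f` is an ODD integer

Summit `BirchSwinnertonDyer`, sub-problem `BirchSwinnertonDyer`, route `ManinLocalTwoThree`; width seat `bsd-line-manin23-p2`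
(gen 9), `--supports` the crux C2 `ManinOddAtFour` (stmt-BirchSwinnertonDyer-22967).  Companion of
`ManinLocalTwoThreeOddDegreeCuspHalfUnit` (`Δ_W < 0`: `6·[0]⁺_f` odd): when `Δ_W > 0` (two real components,
`Ω(W) = 2Ω₀`, `Λ_W ∩ ℝ = ℤΩ₀`) and the datum is lattice-optimal (`Λ_W = c·Λ_f`, `Ω(W) = |c|·Ω⁺_f`, so
`Ω₀ = |c|·Ω⁺_f/2`), an integer value `6·[0]⁺_f = j` would give `c·3{∞,0}_f = ±j·Ω₀ ∈ Λ_W = c·Λ_f`, i.e.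
`3{∞,0}_f ∈ Λ_f`, impossible for odd degree (`three_mul_cuspZeroSymbol_not_mem_of_odd_deg`).  Hence with
`12·[0]⁺_f ∈ ℤ` (`exists_twelve_mul_ratPlusSymbol_zero_eq`): **`12·L(W,1)/Ω⁺_f` is odd**, `v₂([0]⁺_f) = −2` exactly.
Together: for an odd-degree lattice-optimal `X₀(4p)`-datum, `v₂(L(W,1)/Ω⁺_f) = −#π₀(W(ℝ))`.

PROVED here (no `sorry`): `minRealPeriod_eq_of_Δ_pos`, `not_exists_six_mul_ratPlusSymbol_zero_eq_int_of_odd_deg_of_Δ_pos`,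
**`twelve_mul_ratPlusSymbol_zero_odd_of_odd_deg_of_Δ_pos`**.
BSD is not proved by this; Manin's conjecture is not proved by this.
-/

set_option autoImplicit false
set_option linter.dupNamespace false

noncomputable section

open scoped MatrixGroups ModularForm
open CongruenceSubgroup
open Literature.NumberTheory.EllipticCurves Literature.NumberTheory.EllipticCurves.ModularForms

namespace Summit.BirchSwinnertonDyer.BirchSwinnertonDyer.Theorems.ManinLocalTwoThree

/-- **`2·Ω₀(Λ_W) = |c|·Ω⁺_f`** for a lattice-optimal datum of a curve with two real components (`Δ_W > 0`). -/
theorem minRealPeriod_eq_of_Δ_pos {W : WeierstrassCurve ℚ} [W.IsElliptic] {N : ℕ} [NeZero N]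
    (D : ModularParametrizationData W N) (hΔ : 0 < W.Δ)
    (hopt : ∀ z ∈ D.L.lattice, ∃ w ∈ periodLattice D.f, z = D.c * w) :
    2 * D.L.minRealPeriod = |(D.c : ℝ)| * plusPeriod D.f := by
  have hν : (W.baseChange ℝ).numRealComponents = 2 := by
    rw [WeierstrassCurve.numRealComponents_baseChange_real, if_pos hΔ]
  have h1 := D.realPeriodRat_eq_numRealComponents_mul
  rw [hν, Nat.cast_ofNat] at h1
  rw [← h1, D.realPeriodRat_eq_abs_mul_plusPeriod_of_latticeEq hopt]

/-- **Odd degree at `N = 4p`, `Δ_W > 0`, lattice-optimal ⟹ `6·[0]⁺_f ∉ ℤ`.** -/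
theorem not_exists_six_mul_ratPlusSymbol_zero_eq_int_of_odd_deg_of_Δ_pos {W : WeierstrassCurve ℚ} [W.IsElliptic]
    {p : ℕ} [NeZero (4 * p)] (hp : p.Prime) (hp2 : p ≠ 2) (D : ModularParametrizationData W (4 * p))
    (hΔ : 0 < W.Δ) (hopt : ∀ z ∈ D.L.lattice, ∃ w ∈ periodLattice D.f, z = D.c * w) (hodd : Odd D.deg) :
    ¬ ∃ j : ℤ, 6 * ratPlusSymbol D.f 0 = j := by
  rintro ⟨j, hj⟩
  apply three_mul_cuspZeroSymbol_not_mem_of_odd_deg hp hp2 D hodd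
  have hc : (D.c : ℝ) ≠ 0 := Int.cast_ne_zero.mpr D.maninConstant_ne_zero_holds
  have hΩ₀ : (((D.L.minRealPeriod : ℝ)) : ℂ) ∈ D.L.lattice := D.isReal_neronLattice.minRealPeriod_mem_lattice
  have h2Ω₀ := minRealPeriod_eq_of_Δ_pos D hΔ hopt
  -- the sign `s = c/|c| ∈ {±1}`: `c = s·|c|`
  obtain ⟨s, hs1, hsc⟩ : ∃ s : ℤ, (s = 1 ∨ s = -1) ∧ (D.c : ℝ) = s * |(D.c : ℝ)| := by
    rcases lt_or_gt_of_ne hc with hneg | hpos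
    · exact ⟨-1, Or.inr rfl, by rw [abs_of_neg hneg]; push_cast; ring⟩
    · exact ⟨1, Or.inl rfl, by rw [abs_of_pos hpos]; push_cast; ring⟩
  -- `c · 3{∞,0} = (s j) Ω₀ ∈ Λ_W`
  have hmem : (D.c : ℂ) * ((3 : ℂ) * modularSymbol D.f 0) ∈ D.L.lattice := by
    have hz := D.L.lattice.smul_mem (s * j : ℤ) hΩ₀
    convert hz using 1
    rw [modularSymbol_zero_eq_ratPlusSymbol_mul_plusPeriod D, zsmul_eq_mul]
    have hj' : (((6 * ratPlusSymbol D.f 0 : ℚ) : ℝ) : ℂ) = (((j : ℚ) : ℝ) : ℂ) := by rw [hj]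
    have hΩ₀' : ((D.L.minRealPeriod : ℝ) : ℂ) = ((|(D.c : ℝ)| * plusPeriod D.f / 2 : ℝ) : ℂ) := by
      rw [← h2Ω₀]; push_cast; ring
    have hsc' : (((D.c : ℝ)) : ℂ) = (((s : ℝ) * |(D.c : ℝ)| : ℝ) : ℂ) := by rw [← hsc]
    rw [hΩ₀']
    push_cast at hj' hsc' ⊢
    linear_combination ((s : ℂ) * ((|(D.c : ℝ)| : ℝ) : ℂ) * (plusPeriod D.f : ℂ) / 2) * hj' +
      (3 * ((ratPlusSymbol D.f 0 : ℚ) : ℂ) * (plusPeriod D.f : ℂ)) * hsc'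
  obtain ⟨w, hw, hcw⟩ := hopt _ hmem
  have hc' : (D.c : ℂ) ≠ 0 := Int.cast_ne_zero.mpr D.maninConstant_ne_zero_holds
  rwa [mul_left_cancel₀ hc' hcw]

/-- **Odd degree at `N = 4p`, `Δ_W > 0`, lattice-optimal ⟹ `12·L(W,1)/Ω⁺_f` is an ODD integer** (`v₂([0]⁺_f) = −2`). -/
theorem twelve_mul_ratPlusSymbol_zero_odd_of_odd_deg_of_Δ_pos {W : WeierstrassCurve ℚ} [W.IsElliptic]
    {p : ℕ} [NeZero (4 * p)] (hp : p.Prime) (hp2 : p ≠ 2) (D : ModularParametrizationData W (4 * p))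
    (hΔ : 0 < W.Δ) (hopt : ∀ z ∈ D.L.lattice, ∃ w ∈ periodLattice D.f, z = D.c * w) (hodd : Odd D.deg) :
    ∃ k : ℤ, Odd k ∧ 12 * ratPlusSymbol D.f 0 = k := by
  obtain ⟨k, hk⟩ := exists_twelve_mul_ratPlusSymbol_zero_eq hp hp2 D
  refine ⟨k, ?_, hk⟩
  rw [← Int.not_even_iff_odd]
  rintro ⟨j, rfl⟩
  exact not_exists_six_mul_ratPlusSymbol_zero_eq_int_of_odd_deg_of_Δ_pos hp hp2 D hΔ hopt hodd
    ⟨j, by push_cast at hk; linarith⟩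

end Summit.BirchSwinnertonDyer.BirchSwinnertonDyer.Theorems.ManinLocalTwoThree

end
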